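import Summits.CriticalPhenomena.PercolationContinuityZ3.Theorems.PercNearOneGluingNoHeavyLowerTailSahiCombTriWShell

/-!
# `TRI_W(a) ≥ 0` for EVERY index cube when the fibre cube has dimension two: the eight-up-set inequality

Support file of the one-cut programme (crux `NoHeavyLowerTail`, stmt-CriticalPhenomena-4575; cell `prim-masterthm`, seat P5 gen 22;
memo `FROM-prim-masterthm-p5-g22-SEPARABLE-CERTIFICATES.md` §6).  Target of the lane: `FiveUpSet.TriWIneq` (`…SahiCombTriWGeneral`, OPEN for `a ≥ 2`).

Write `α_e = idxSet F e = {x | e ∈ F x}`, `β_e = idxSet G e` for the index profiles (up-sets of the index cube `Finset β` when `F, G` are monotone).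
By the Kleitman–shell normal form (`triW_eq_shell`) and double counting, `triW P F G` is the INDEX-PROFILE FORM
`Σ_{e ∈ P} (2·#(α_e ∩ β_e) − #(α_e ∩ refl β_{eᶜ}) − #(β_e ∩ refl α_{eᶜ})) − Σ_{e ∈ refl P} (#(α_e ∩ β_e) − #(α_e ∩ refl β_e))` (`triW_eq_idxForm`).
For the fibre cube `W = Finset (Fin 2)` and `P = W \ {∅}` (the only up-set of `W` that is neither principal nor `refl`-closed) this is a
functional of EIGHT up-sets `a₀ ⊆ a₁, a₂ ⊆ a₃`, `b₀ ⊆ b₁, b₂ ⊆ b₃` of the index cube (`a_u = α_u`, `u ∈ {∅,{0},{1},univ}`):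
`T = −#(a₀b₀) + #(a₀ r b₀) − #(a₀ r b₃) + #(a₁b₁) + #(a₁ r b₁) − 2#(a₁ r b₂) + #(a₂b₂) + #(a₂ r b₂) − 2#(a₂ r b₁) + 2#(a₃b₃) − #(a₃ r b₀)` (`r = refl`).

* **`FiveUpSet.eightUpSet_ineq`** — `0 ≤ T` for all such up-sets of ANY finite cube.  PROOF (found by an exact type-level LP, `code22/kit/cpcone/r3lp.py`,
  then verified symbolically): `2T = 2·Kl(a₃;b₃) + 2·Kl(b₃;a₁) + Kl_{a₂∪b₁}(a₃;b₁) + Kl_{a₂∪b₁}(b₁;a₂) + Σ_x ρ(x)`, where `Kl_U(A;B) = #(U∩A∩B) − #(U∩A∩refl B) ≥ 0`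
  are four Kleitman gaps in the index cube (`card_inter_refl_le`) and the pointwise remainder satisfies `ρ(x) + ρ(xᶜ) ≥ 0` for every point `x`
  (a finite check over the `6⁴` profile patterns of the antipodal pair `{x, xᶜ}`, kernel `decide`).
* **`FiveUpSet.triW_nonneg_fin_two_sdiff_empty`** — `0 ≤ triW (univ.erase ∅) F G` for `γ = Fin 2` and EVERY index cube `Finset β`, all monotone
  families of up-sets; together with `triW_nonneg_of_refl_subset` (`P = univ`), `triW_nonneg_of_principal` (`P = ↑{i}`, `P = {univ}`) and `P = ∅`
  this is `TriWIneq` on every cell `(a, 2)` — the first stratum defined by the size of the FIBRE cube with the index cube arbitrary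
  (census reached `a ≤ 4`; the certificate has four Kleitman gaps, uniformly in `a`).
HONEST LABEL: complete proofs, std axioms; a new unconditional stratum (`n = 2`, all `a`); `TriWIneq` for `n ≥ 3`, `a ≥ 2` stays OPEN. [this work]
-/

namespace Summit.CriticalPhenomena.PercolationContinuityZ3.Theorems

namespace FiveUpSet

open Finset

variable {β : Type} [DecidableEq β] [Fintype β]

/-! ### Bookkeeping: cardinalities as sums of indicator bits over the index cube -/

/-- `0/1`-valued integer of a Boolean. [this work] -/
def bi (b : Bool) : ℤ := if b then 1 else 0

/-- `#(A ∩ B) = Σ_x [x ∈ A][x ∈ B]`. [this work] -/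
theorem cardZ_inter (A B : Finset (Finset β)) :
    ((A ∩ B).card : ℤ) = ∑ x, bi (decide (x ∈ A) && decide (x ∈ B)) := by
  have h : ∀ x, bi (decide (x ∈ A) && decide (x ∈ B)) = if x ∈ A ∩ B then (1 : ℤ) else 0 := by
    intro x
    by_cases h1 : x ∈ A <;> by_cases h2 : x ∈ B <;> simp [bi, h1, h2]
  rw [Finset.sum_congr rfl (fun x _ => h x), Finset.sum_boole, Finset.filter_univ_mem]

/-- `#(A ∩ refl B) = Σ_x [x ∈ A][xᶜ ∈ B]`. [this work] -/
theorem cardZ_inter_refl (A B : Finset (Finset β)) :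
    ((A ∩ refl B).card : ℤ) = ∑ x, bi (decide (x ∈ A) && decide (xᶜ ∈ B)) := by
  have h : ∀ x, bi (decide (x ∈ A) && decide (xᶜ ∈ B)) = if x ∈ A ∩ refl B then (1 : ℤ) else 0 := by
    intro x
    by_cases h1 : x ∈ A <;> by_cases h2 : xᶜ ∈ B <;> simp [bi, h1, h2, mem_refl]
  rw [Finset.sum_congr rfl (fun x _ => h x), Finset.sum_boole, Finset.filter_univ_mem]

/-! ### The relative Kleitman gap -/

/-- The relative Kleitman gap `Kl_U(A;B) = #(U ∩ A ∩ B) − #(U ∩ A ∩ refl B)`. [this work] -/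
def klGap (U A B : Finset (Finset β)) : ℤ := ((U ∩ A ∩ B).card : ℤ) - (U ∩ A ∩ refl B).card

/-- Kleitman's lemma in the index cube: `Kl_U(A;B) ≥ 0` for up-sets `U, A, B`. [this work] -/
theorem klGap_nonneg {U A B : Finset (Finset β)} (hU : IsUpperSet (U : Set (Finset β)))
    (hA : IsUpperSet (A : Set (Finset β))) (hB : IsUpperSet (B : Set (Finset β))) : 0 ≤ klGap U A B := by
  have hUA : IsUpperSet ((U ∩ A : Finset (Finset β)) : Set (Finset β)) := by rw [coe_inter]; exact hU.inter hA
  have h := card_inter_refl_le hUA hB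
  unfold klGap
  omega

/-! ### The eight-up-set functional and its pointwise bookkeeping -/

/-- The eight-up-set functional `T` (= `triW` on the cell `(a,2)` at `P = W \ {∅}`, in index-profile coordinates). [this work] -/
def eightT (a₀ a₁ a₂ a₃ b₀ b₁ b₂ b₃ : Finset (Finset β)) : ℤ :=
  -((a₀ ∩ b₀).card : ℤ) + (a₀ ∩ refl b₀).card - (a₀ ∩ refl b₃).card
    + (a₁ ∩ b₁).card + (a₁ ∩ refl b₁).card - 2 * ((a₁ ∩ refl b₂).card : ℤ)
    + (a₂ ∩ b₂).card + (a₂ ∩ refl b₂).card - 2 * ((a₂ ∩ refl b₁).card : ℤ)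
    + 2 * ((a₃ ∩ b₃).card : ℤ) - (a₃ ∩ refl b₀).card

/-- The certificate: four Kleitman gaps. [this work] -/
def eightCert (a₁ a₂ a₃ b₁ b₃ : Finset (Finset β)) : ℤ :=
  2 * klGap univ a₃ b₃ + 2 * klGap univ b₃ a₁ + klGap (a₂ ∪ b₁) a₃ b₁ + klGap (a₂ ∪ b₁) b₁ a₂

/-- Pointwise integrand of `2T − certificate` at a point `x`, as a function of the 16 membership bits of `x` (unprimed) and of `xᶜ`
(primed) in `a₀..a₃, b₀..b₃`. [this work] -/
def rho (A0 A1 A2 A3 B0 B1 B2 B3 _A0' A1' A2' _A3' B0' B1' B2' B3' : Bool) : ℤ :=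
  2 * (-(bi (A0 && B0)) + bi (A0 && B0') - bi (A0 && B3') + bi (A1 && B1) + bi (A1 && B1') - 2 * bi (A1 && B2')
      + bi (A2 && B2) + bi (A2 && B2') - 2 * bi (A2 && B1') + 2 * bi (A3 && B3) - bi (A3 && B0'))
  - (2 * (bi (true && A3 && B3) - bi (true && A3 && B3')) + 2 * (bi (true && B3 && A1) - bi (true && B3 && A1'))
      + (bi ((A2 || B1) && A3 && B1) - bi ((A2 || B1) && A3 && B1'))
      + (bi ((A2 || B1) && B1 && A2) - bi ((A2 || B1) && B1 && A2')))

/-- The six monotone membership patterns `(x ∈ c₀, x ∈ c₁, x ∈ c₂, x ∈ c₃)` of a point in a square of up-sets `c₀ ⊆ c₁, c₂ ⊆ c₃`. [this work] -/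
def pat : Fin 6 → Bool × Bool × Bool × Bool
  | 0 => (false, false, false, false)
  | 1 => (false, false, false, true)
  | 2 => (false, true, false, true)
  | 3 => (false, false, true, true)
  | 4 => (false, true, true, true)
  | 5 => (true, true, true, true)

/-- Every monotone pattern is one of the six. [this work] -/
theorem exists_pat (u v w z : Bool) (h1 : u = true → v = true) (h2 : u = true → w = true) (h3 : v = true → z = true)
    (h4 : w = true → z = true) : ∃ i : Fin 6, pat i = (u, v, w, z) := by
  revert u v w z
  decide

/-- `rho` on a pair of antipodal points, in pattern coordinates. [this work] -/
def rhoPair (i j k l : Fin 6) : ℤ :=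
  rho (pat i).1 (pat i).2.1 (pat i).2.2.1 (pat i).2.2.2 (pat j).1 (pat j).2.1 (pat j).2.2.1 (pat j).2.2.2
      (pat k).1 (pat k).2.1 (pat k).2.2.1 (pat k).2.2.2 (pat l).1 (pat l).2.1 (pat l).2.2.1 (pat l).2.2.2
    + rho (pat k).1 (pat k).2.1 (pat k).2.2.1 (pat k).2.2.2 (pat l).1 (pat l).2.1 (pat l).2.2.1 (pat l).2.2.2
      (pat i).1 (pat i).2.1 (pat i).2.2.1 (pat i).2.2.2 (pat j).1 (pat j).2.1 (pat j).2.2.1 (pat j).2.2.2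

/-- **The pointwise remainder is non-negative on every antipodal pair** (`6⁴ = 1296` pattern cases, kernel `decide`). [this work] -/
theorem rhoPair_nonneg : ∀ i j k l : Fin 6, 0 ≤ rhoPair i j k l := by
  decide

/-- Unfolding `rhoPair` at given patterns. [this work] -/
theorem rho_add_rho_nonneg (a0 a1 a2 a3 b0 b1 b2 b3 a0' a1' a2' a3' b0' b1' b2' b3' : Bool) (i j k l : Fin 6)
    (hi : pat i = (a0, a1, a2, a3)) (hj : pat j = (b0, b1, b2, b3)) (hk : pat k = (a0', a1', a2', a3')) (hl : pat l = (b0', b1', b2', b3')) :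
    0 ≤ rho a0 a1 a2 a3 b0 b1 b2 b3 a0' a1' a2' a3' b0' b1' b2' b3' + rho a0' a1' a2' a3' b0' b1' b2' b3' a0 a1 a2 a3 b0 b1 b2 b3 := by
  have h := rhoPair_nonneg i j k l
  unfold rhoPair at h
  simpa only [hi, hj, hk, hl] using h

/-! ### The theorem -/

/-- **The eight-up-set inequality.**  For up-sets `a₀ ⊆ a₁, a₂ ⊆ a₃` and `b₀ ⊆ b₁, b₂ ⊆ b₃` of a finite cube (`a₁, a₂` incomparable in general),
`0 ≤ −#(a₀b₀) + #(a₀ r b₀) − #(a₀ r b₃) + #(a₁b₁) + #(a₁ r b₁) − 2#(a₁ r b₂) + #(a₂b₂) + #(a₂ r b₂) − 2#(a₂ r b₁) + 2#(a₃b₃) − #(a₃ r b₀)` (`r = refl`).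
Proof: `2T − [2Kl(a₃;b₃) + 2Kl(b₃;a₁) + Kl_{a₂∪b₁}(a₃;b₁) + Kl_{a₂∪b₁}(b₁;a₂)] = Σ_x ρ(x)` with `ρ(x) + ρ(xᶜ) ≥ 0` pointwise; the four gaps are
`≥ 0` by Kleitman's lemma. [this work] -/
theorem eightUpSet_ineq (a₀ a₁ a₂ a₃ b₀ b₁ b₂ b₃ : Finset (Finset β))
    (ha₁ : IsUpperSet (a₁ : Set (Finset β))) (ha₂ : IsUpperSet (a₂ : Set (Finset β))) (ha₃ : IsUpperSet (a₃ : Set (Finset β)))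
    (hb₁ : IsUpperSet (b₁ : Set (Finset β))) (hb₃ : IsUpperSet (b₃ : Set (Finset β)))
    (h01 : a₀ ⊆ a₁) (h02 : a₀ ⊆ a₂) (h13 : a₁ ⊆ a₃) (h23 : a₂ ⊆ a₃)
    (k01 : b₀ ⊆ b₁) (k02 : b₀ ⊆ b₂) (k13 : b₁ ⊆ b₃) (k23 : b₂ ⊆ b₃) :
    0 ≤ eightT a₀ a₁ a₂ a₃ b₀ b₁ b₂ b₃ := by
  -- (1) the certificate is non-negative
  have hcert : 0 ≤ eightCert a₁ a₂ a₃ b₁ b₃ := by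
    have hu : IsUpperSet ((univ : Finset (Finset β)) : Set (Finset β)) := by rw [coe_univ]; exact isUpperSet_univ
    have hU : IsUpperSet ((a₂ ∪ b₁ : Finset (Finset β)) : Set (Finset β)) := by rw [coe_union]; exact ha₂.union hb₁
    have g1 := klGap_nonneg hu ha₃ hb₃
    have g2 := klGap_nonneg hu hb₃ ha₁
    have g3 := klGap_nonneg hU ha₃ hb₁
    have g4 := klGap_nonneg hU hb₁ ha₂
    unfold eightCert
    linarith
  -- (2) the pointwise identity  2T − cert = Σ_x ρ(x)
  set R : Finset β → ℤ := fun x => rho (decide (x ∈ a₀)) (decide (x ∈ a₁)) (decide (x ∈ a₂)) (decide (x ∈ a₃))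
      (decide (x ∈ b₀)) (decide (x ∈ b₁)) (decide (x ∈ b₂)) (decide (x ∈ b₃))
      (decide (xᶜ ∈ a₀)) (decide (xᶜ ∈ a₁)) (decide (xᶜ ∈ a₂)) (decide (xᶜ ∈ a₃))
      (decide (xᶜ ∈ b₀)) (decide (xᶜ ∈ b₁)) (decide (xᶜ ∈ b₂)) (decide (xᶜ ∈ b₃)) with hR
  have hid : 2 * eightT a₀ a₁ a₂ a₃ b₀ b₁ b₂ b₃ - eightCert a₁ a₂ a₃ b₁ b₃ = ∑ x, R x := by
    have huniv : ∀ x : Finset β, decide (x ∈ (univ : Finset (Finset β))) = true := fun x => by simp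
    have hun : ∀ x : Finset β, decide (x ∈ a₂ ∪ b₁) = (decide (x ∈ a₂) || decide (x ∈ b₁)) := fun x => by
      by_cases h1 : x ∈ a₂ <;> by_cases h2 : x ∈ b₁ <;> simp [h1, h2]
    have hinter : ∀ (x : Finset β) (s t : Finset (Finset β)), decide (x ∈ s ∩ t) = (decide (x ∈ s) && decide (x ∈ t)) :=
      fun x s t => by by_cases h1 : x ∈ s <;> by_cases h2 : x ∈ t <;> simp [h1, h2]
    have hrefl : ∀ (x : Finset β) (s : Finset (Finset β)), decide (x ∈ refl s) = decide (xᶜ ∈ s) :=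
      fun x s => by by_cases h1 : xᶜ ∈ s <;> simp [h1, mem_refl]
    unfold eightT eightCert klGap
    simp only [cardZ_inter, hrefl, hinter, huniv, hun, Bool.true_and]
    simp only [Finset.mul_sum, ← Finset.sum_neg_distrib, ← Finset.sum_add_distrib, ← Finset.sum_sub_distrib]
    refine Finset.sum_congr rfl fun x _ => ?_
    rw [hR]
    unfold rho
    simp only [Bool.true_and]
  -- (3) Σ_x ρ(x) ≥ 0 by pairing x with xᶜ
  have hsum : 0 ≤ ∑ x, R x := by
    have hre : ∑ x : Finset β, R xᶜ = ∑ x : Finset β, R x :=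
      Fintype.sum_equiv (complEquiv β) _ _ (fun x => rfl)
    have h2 : 2 * ∑ x, R x = ∑ x, (R x + R xᶜ) := by rw [sum_add_distrib, hre]; ring
    have hpt : ∀ x, 0 ≤ R x + R xᶜ := by
      intro x
      have mono : ∀ {c d : Finset (Finset β)} (y : Finset β), c ⊆ d → decide (y ∈ c) = true → decide (y ∈ d) = true :=
        fun y hcd hy => by simp only [decide_eq_true_eq] at hy ⊢; exact hcd hy
      obtain ⟨i, hi⟩ := exists_pat (decide (x ∈ a₀)) (decide (x ∈ a₁)) (decide (x ∈ a₂)) (decide (x ∈ a₃))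
        (mono x h01) (mono x h02) (mono x h13) (mono x h23)
      obtain ⟨j, hj⟩ := exists_pat (decide (x ∈ b₀)) (decide (x ∈ b₁)) (decide (x ∈ b₂)) (decide (x ∈ b₃))
        (mono x k01) (mono x k02) (mono x k13) (mono x k23)
      obtain ⟨k, hk⟩ := exists_pat (decide (xᶜ ∈ a₀)) (decide (xᶜ ∈ a₁)) (decide (xᶜ ∈ a₂)) (decide (xᶜ ∈ a₃))
        (mono xᶜ h01) (mono xᶜ h02) (mono xᶜ h13) (mono xᶜ h23)
      obtain ⟨l, hl⟩ := exists_pat (decide (xᶜ ∈ b₀)) (decide (xᶜ ∈ b₁)) (decide (xᶜ ∈ b₂)) (decide (xᶜ ∈ b₃))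
        (mono xᶜ k01) (mono xᶜ k02) (mono xᶜ k13) (mono xᶜ k23)
      have h := rho_add_rho_nonneg _ _ _ _ _ _ _ _ _ _ _ _ _ _ _ _ i j k l hi hj hk hl
      rw [hR]
      simp only [compl_compl] at h ⊢
      exact h
    have : 0 ≤ ∑ x, (R x + R xᶜ) := sum_nonneg fun x _ => hpt x
    linarith
  linarith

/-! ### The index-profile form of `triW` and the cell `(a, 2)` -/

variable {γ : Type} [DecidableEq γ] [Fintype γ]

/-- Double counting with the second profile reflected at the antipodal point:
`Σ_{e ∈ P} #(α_e ∩ refl β_{eᶜ}) = Σ_x #(P ∩ F x ∩ refl (G xᶜ))`. [this work] -/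
theorem sum_card_idxSet_inter_refl_compl (P : Finset (Finset γ)) (F G : Finset β → Finset (Finset γ)) :
    ∑ e ∈ P, ((idxSet F e ∩ refl (idxSet G eᶜ)).card : ℤ) = ∑ x : Finset β, ((P ∩ F x ∩ refl (G xᶜ)).card : ℤ) := by
  have h1 : ∀ e, ((idxSet F e ∩ refl (idxSet G eᶜ)).card : ℤ)
      = ∑ x : Finset β, (if e ∈ F x ∧ eᶜ ∈ G xᶜ then (1 : ℤ) else 0) := by
    intro e
    rw [Finset.sum_boole]
    congr 2
    ext x; simp [idxSet, mem_refl]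
  have h2 : ∀ x : Finset β, ((P ∩ F x ∩ refl (G xᶜ)).card : ℤ) = ∑ e ∈ P, (if e ∈ F x ∧ eᶜ ∈ G xᶜ then (1 : ℤ) else 0) := by
    intro x
    rw [Finset.sum_boole]
    congr 2
    ext e; simp [mem_refl]
  simp only [h1, h2]
  exact Finset.sum_comm

/-- **Index-profile form of `TRI_W(a)`** (every `P`, every cube): with `α_e = idxSet F e`, `β_e = idxSet G e`,
`triW P F G = Σ_{e ∈ P} (2·#(α_e ∩ β_e) − #(α_e ∩ refl β_{eᶜ}) − #(β_e ∩ refl α_{eᶜ})) − Σ_{e ∈ refl P} (#(α_e ∩ β_e) − #(α_e ∩ refl β_e))`. [this work] -/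
theorem triW_eq_idxForm (P : Finset (Finset γ)) (F G : Finset β → Finset (Finset γ)) :
    triW P F G = ∑ e ∈ P, (2 * ((idxSet F e ∩ idxSet G e).card : ℤ) - (idxSet F e ∩ refl (idxSet G eᶜ)).card
        - (idxSet G e ∩ refl (idxSet F eᶜ)).card)
      - ∑ e ∈ refl P, (((idxSet F e ∩ idxSet G e).card : ℤ) - (idxSet F e ∩ refl (idxSet G e)).card) := by
  rw [triW_eq_shell]
  have hK : ∑ e ∈ P, ((((idxSet F e ∩ refl (idxSet G e)).card : ℤ) - (idxSet F e ∩ refl (idxSet G eᶜ)).card)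
      + (((idxSet G e ∩ refl (idxSet F e)).card : ℤ) - (idxSet G e ∩ refl (idxSet F eᶜ)).card)) = kleitmanPart P F G := by
    unfold kleitmanPart
    simp only [sum_add_distrib, sum_sub_distrib, sum_card_idxSet_inter_refl, sum_card_idxSet_inter_refl_compl]
  have hcomm : ∀ e, ((idxSet G e ∩ refl (idxSet F e)).card : ℤ) = ((idxSet F e ∩ refl (idxSet G e)).card : ℤ) := by
    intro e
    rw [← card_refl (idxSet G e ∩ refl (idxSet F e)), refl_inter, refl_refl, inter_comm]
  rw [← hK, Finset.mul_sum, ← sum_add_distrib]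
  congr 1
  refine sum_congr rfl fun e _ => ?_
  unfold shellWeight
  rw [hcomm e]
  ring

/-- **`TriWIneq` on the cell `(a, 2)` at `P = W \ {∅}`**: for `γ = Fin 2`, EVERY finite index type `β`, and monotone families `F, G` of up-sets of
`Finset (Fin 2)`, `0 ≤ triW (univ.erase ∅) F G`.  (The other up-sets of `Finset (Fin 2)` — `∅`, `{univ}`, `↑{0}`, `↑{1}`, `univ` — are principal or
`refl`-closed: `triW_nonneg_of_principal`, `triW_nonneg_of_refl_subset`.)  Proof: `triW_eq_idxForm` turns `triW` into the eight-up-set functional of the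
four index profiles `α_∅ ⊆ α_{0}, α_{1} ⊆ α_univ` (and `β`), and `eightUpSet_ineq` applies. [this work] -/
theorem triW_nonneg_fin_two_sdiff_empty (F G : Finset β → Finset (Finset (Fin 2)))
    (hF : ∀ x, IsUpperSet (F x : Set (Finset (Fin 2)))) (hG : ∀ x, IsUpperSet (G x : Set (Finset (Fin 2))))
    (hFm : Monotone F) (hGm : Monotone G) :
    0 ≤ triW ((univ : Finset (Finset (Fin 2))).erase ∅) F G := by
  rw [triW_eq_idxForm]
  -- the fibre cube: univ.erase ∅ = { {0}, {1}, univ } and refl (univ.erase ∅) = { ∅, {0}, {1} }  -- wait: {0}ᶜ = {1}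
  have hP : ((univ : Finset (Finset (Fin 2))).erase ∅) = {{0}, {1}, (univ : Finset (Fin 2))} := by decide
  have hrP : refl (((univ : Finset (Finset (Fin 2))).erase ∅)) = {{1}, {0}, (∅ : Finset (Fin 2))} := by decide
  have c0 : ({0} : Finset (Fin 2))ᶜ = {1} := by decide
  have c1 : ({1} : Finset (Fin 2))ᶜ = {0} := by decide
  have cu : (univ : Finset (Fin 2))ᶜ = ∅ := by simp
  have ce : (∅ : Finset (Fin 2))ᶜ = univ := by simp
  rw [hrP, hP]
  rw [sum_insert (by decide), sum_insert (by decide), sum_singleton, sum_insert (by decide), sum_insert (by decide), sum_singleton]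
  rw [c0, c1, cu]
  -- monotonicity of the profiles: α_∅ ⊆ α_{0}, α_{1} ⊆ α_univ
  have mono : ∀ {H : Finset β → Finset (Finset (Fin 2))}, (∀ x, IsUpperSet (H x : Set (Finset (Fin 2)))) →
      ∀ {u v : Finset (Fin 2)}, u ⊆ v → idxSet H u ⊆ idxSet H v := by
    intro H hH u v huv x hx
    rw [mem_idxSet] at hx ⊢
    exact hH x huv hx
  have e0 : (∅ : Finset (Fin 2)) ⊆ {0} := empty_subset _
  have e1 : (∅ : Finset (Fin 2)) ⊆ {1} := empty_subset _
  have u0 : ({0} : Finset (Fin 2)) ⊆ univ := subset_univ _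
  have u1 : ({1} : Finset (Fin 2)) ⊆ univ := subset_univ _
  have key := eightUpSet_ineq (idxSet F ∅) (idxSet F {0}) (idxSet F {1}) (idxSet F univ)
    (idxSet G ∅) (idxSet G {0}) (idxSet G {1}) (idxSet G univ)
    (isUpperSet_idxSet hFm _) (isUpperSet_idxSet hFm _) (isUpperSet_idxSet hFm _)
    (isUpperSet_idxSet hGm _) (isUpperSet_idxSet hGm _)
    (mono hF e0) (mono hF e1) (mono hF u0) (mono hF u1) (mono hG e0) (mono hG e1) (mono hG u0) (mono hG u1)
  unfold eightT at key
  have hcomm : ∀ u v, ((idxSet G u ∩ refl (idxSet F v)).card : ℤ) = ((idxSet F v ∩ refl (idxSet G u)).card : ℤ) := by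
    intro u v
    rw [← card_refl (idxSet G u ∩ refl (idxSet F v)), refl_inter, refl_refl, inter_comm]
  rw [hcomm, hcomm, hcomm]
  linarith

end FiveUpSet

end Summit.CriticalPhenomena.PercolationContinuityZ3.Theorems
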